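import Literature.LinearAlgebra.Alternating.DerivationExtension
import Mathlib.Analysis.Normed.Operator.Mul
import Mathlib.Algebra.Central.Matrix
import Mathlib.Analysis.Matrix.Normed
import Mathlib.LinearAlgebra.Trace
import Mathlib.LinearAlgebra.Matrix.StdBasis
import HarnessLib

/-!
# Projectively hyperholomorphic curvature: `End(B)` is hyperholomorphic iff the traceless curvature
# `Θ_tl = Θ − (1/r) Tr Θ` is `G_M`-invariant (Verbitsky 1996, Def. 11.1–11.2, Prop. 11.1), pointwise

Topic `Literature/Geometry/Hyperkaehler`, namespace `Literature.Geometry.Hyperkaehler`. Written by the literature seat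
`lit-w-verbitsky` (gen 6) of the cell `pub-hsemireg` (HodgeConjecture venture), 2026-08-23, as the kernel leg of row
V-V22 of that cell's Verbitsky table. Verbitsky's `ad T` on `W`-valued `k`-covectors is `adAlt T`
(`LinearAlgebra/Alternating/DerivationExtension.lean`); "`G_M`-invariant" is rendered infinitesimally, one derivation
`ad T` at a time (for a hyperkähler structure one takes `T = I` and `T = J`, `IsotropyAlgebraAction.lean`).

## Source, verbatim (arXiv:alg-geom/9307008v1, 29 Jul 1993, pp. 39–40 = J. Alg. Geom. 5 (1996) 633–669, §11)

* **Definition 11.1.** "Let `B` be a bundle of rank `r` with connection and a curvature `Θ ∈ Λ²(End(B))`. Take the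
  2-form `Tr(Θ) ∈ Λ²(ℂ)`. The `End(B)`-valued 2-form `Θ_tl := Θ − (1/r) Tr(Θ)` is called traceless curvature of `B`."
* **Definition 11.2.** "Let `B` be a Hermitian holomorphic bundle over `(M, I)` with a traceless curvature `Θ_tl`. The
  bundle `B` is called projectively hyperholomorphic if `Θ_tl` is `G_M`-invariant. By `G_M` we mean the isotropy group
  of `M`, see Definition 1.2."
* **Proposition 11.1.** "The Hermitian holomorphic bundle `B` over `M` is projectively hyperholomorphic if and only if
  `End(B)` is hyperholomorphic as a bundle with connection induced from `B`. Proof (See [Ko] for analogous results:)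
  The curvature `Θ₁` of `End(B)` maps a `End(B)`-valued form `α` to `α ∧ Θ − Θ ∧ α`, where `Θ` is a curvature form
  in `B`. This implies `Θ₁α = θ ∧ α − α ∧ Θ = Θ_tl ∧ α − α ∧ Θ_tl`, because the scalar 2-form `Tr(Θ)` commutes with
  `α`. The last form is `G_M`-invariant if `B` is projectively hyperholomorphic, and therefore `End(B)` is
  hyperholomorphic if `B` is projectively hyperholomorphic. Conversely, assume that `Θ₁` is `G_M`-invariant, or, what
  is the same, that `End(B)` is hyperholomorphic. Let `Θ = ∑ᵢ Aᵢωᵢ`, where `ωᵢ ∈ Λ²(M)` and `Aᵢ ∈ End(B)`. Take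
  `A ∈ Γ(End(B))` as the section of `Λ⁰(M, End(B))`. Since `A` and `Θ₁` are `G_M`-invariant differential forms, the
  form `Θ₁(A) = ∑ᵢ [A, Aᵢ]ωᵢ` is also `G_M`-invariant. Therefore for any non-`G_M`-invariant `ωᵢ` the commutator
  `[A, Aᵢ] = 0` for any `A`. Therefore `Aᵢ = f · Id` for such `i`, where `f` is a scalar function, and `Θ_tl` is
  `G_M`-invariant."

Appended source for §6 — [Markman2020BBClass] E. Markman, *The Beauville–Bogomolov class as a characteristic class*,
J. Alg. Geom. 29 (2020) 199–245 = arXiv:1105.3223v4 (read on the v4 PDF; page/line = its text layer): §2 eq. (2.1),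
p.5 L8–33: "Let `Y` be a topological space and `y` a class in the ring `K_top Y` generated by classes of complex vector
bundles over `Y`. Assume that the rank `r` of `y` is non-zero. Set `κ(y) := ch(y) ∪ exp(−c₁(y)/r)`, and let `κᵢ(y)` be
the summand of `κ(y)` in `H^{2i}(Y, ℚ)`. In terms of the Chern roots `y_j`, we have `chᵢ(E) = Σ_j y_jⁱ/i!`,
`c₁(E) = Σ_j y_j`, and `κᵢ(y) = Σ_{j=1}^{r} [y_j − (Σ_k y_k)/r]ⁱ / i!`." p.5 L34–42: "The characteristic class `κ` is
multiplicative, `κ(y₁ ⊗ y₂) = κ(y₁) ∪ κ(y₂)`, and `κ([L]) = 1`, for any line bundle `L`. Given a vector bundle `E` over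
`Y`, the equality `κ(E) = κ(E ⊗ L)` thus holds, for any line bundle `L`. Note the equalities `κᵢ(y^∨) = (−1)ⁱκᵢ(y)`,
`κ(−y) = −κ(y)`." **Lemma 2.4** (p.7 L19–20): "Let `F` be a reflexive coherent, possibly twisted, sheaf of rank `r`
over a complex manifold `X`. Then `c₂(End(F)) = −2rκ₂(F)`." Proof (p.7 L21–27): "… We may thus assume that `F` is
locally free … Note that `κ₂(F^*) = κ₂(F)`, since `κᵢ(F^*) = (−1)ⁱκᵢ(F)` for a locally free `F`. We have,
`κ(End(F)) = κ(F)κ(F^*) = (r + κ₂(F) + …)(r + κ₂(F^*) + …) = r² + 2rκ₂(F) + …` The claimed identity now follows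
from the equalities `κ₂(End(F)) = ch₂(End(F)) = −c₂(End(F))`."

## What is formalised (theorems only; no definition, no named fact, no `sorry`)

Everything is pointwise linear algebra at one point `x ∈ M`, for a curvature value `Θ ∈ Alt^k_ℝ(E; A)` =
`E [⋀^Fin k]→L[ℝ] A` on the real tangent space `E = T_x M` with values in a normed `ℝ`-algebra `A` (the fibre
`End(B_x) ≅ M_r(ℂ)`; any degree `k`, the source has `k = 2`) and ONE continuous endomorphism `T` of `E` (an induced
complex structure). The curvature `Θ₁ = ad Θ` of `End(B)` is the `End(End B_x)`-valued covector `a ↦ [Θ, a]`; since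
`ad T` commutes with post-composition by linear maps of the values (`compContinuousAlternatingMap_adAlt`), "`Θ₁` is
`ad T`-invariant" is "`ad T` kills `Θ₁(a) = −[a, Θ]` for every `a ∈ End(B_x)`" — exactly the form `Θ₁(A)` used in the
printed proof — and the commutator `[a, Θ]` is the post-composition of `Θ` with the inner derivation
`x ↦ a x − x a`, written `ContinuousLinearMap.mul ℝ A a − (ContinuousLinearMap.mul ℝ A).flip a`.

* §1 `adAlt_commutator_comp`: `ad T [a, Θ] = [a, ad T Θ]`.
* §2 **`forall_adAlt_commutator_eq_zero_iff_forall_commute`** (Prop. 11.1, centre form, any normed algebra `A`):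
  `ad T [a, Θ] = 0` for all `a` **iff** every value `(ad T Θ)(v)` is central in `A` ("`[A, Aᵢ] = 0` for any `A`").
* §3 **`forall_adAlt_commutator_eq_zero_iff_adAlt_sub_eq_zero`** (Prop. 11.1 with Def. 11.1–11.2): for a continuous
  linear "normalised trace" `τ : A → A` taking central values and fixing central elements (for `A = M_r(ℂ)`:
  `τ(X) = (1/r) Tr(X) · Id`), `ad T [a, Θ] = 0` for all `a` **iff** `ad T (Θ − τ ∘ Θ) = 0` — i.e. `End(B)` is
  hyperholomorphic iff the traceless curvature `Θ_tl = Θ − (1/r) Tr(Θ)` is invariant ("Therefore `Aᵢ = f · Id` … and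
  `Θ_tl` is `G_M`-invariant"); `exists_eq_algebraMap_of_forall_adAlt_commutator_eq_zero`: in a CENTRAL `𝕜`-algebra the
  central values are scalars `f · Id`.
* §4 (appended; LOCAL instances `Matrix.linftyOpNormedAddCommGroup / …NormedSpace / …NormedRing / …NormedAlgebra`,
  since Mathlib gives `Matrix n n α` no global norm — any norm would do, the statements are algebraic) the matrix
  algebra `A = M_n(ℂ)` itself: `τ(X) = ((card n)⁻¹ · Tr X) · 1` has central values (`matrix_normalisedTrace_central`)
  and fixes every central matrix (`matrix_normalisedTrace_of_central`, by `Matrix.center_eq_range`), it exists as a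
  continuous `ℝ`-linear map (`exists_matrix_normalisedTraceCLM`), and
  **`matrix_forall_adAlt_commutator_eq_zero_iff_adAlt_traceless_eq_zero`** is Prop. 11.1 at a point for
  `M_n(ℂ)`-valued curvature with Def. 11.1's `Θ_tl = Θ − (1/r) Tr(Θ) · Id` written out VERBATIM.
* §5 (appended) the algebra behind **Thm. 11.1**'s class `c₂(B) − ((r−1)/(2r)) c₁(B)²` ("This also follows from
  Theorem 2.5 applied to the bundle `End(B)` and Proposition 11.1"): on `M_n(R)`, `R` any commutative ring,
  `trace_adMatrix_eq_zero` (`Tr(ad X) = 0`, i.e. `c₁(End B) = 0`) and **`trace_adMatrix_sq`**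
  (`Tr((ad X)²) = 2n·Tr(X²) − 2(Tr X)²`), combined in `trace_adMatrix_chernTwo` — by Chern–Weil this is
  `c₂(End B) = 2r·c₂(B) − (r−1)·c₁(B)² = 2r·(c₂(B) − ((r−1)/(2r)) c₁(B)²)`; the Chern–Weil dictionary itself is not
  re-done here.
* §6 (appended) **Markman's `κ`-class dictionary** for the same class ([Markman2020BBClass] §2: `κ(y) := ch(y) ∪
  exp(−c₁(y)/r)`, "`κᵢ(y) = Σ_j [y_j − (Σ_k y_k)/r]ⁱ / i!`" — i.e. `κ` is `ch` of the Chern roots of the TRACELESS PART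
  `X_tl = X − ((1/n) Tr X)·1` of Def. 11.1, so `κ₁ ↔ Tr X_tl = 0`, `κ₂ ↔ ½Tr(X_tl²)`, and Thm. 11.1's class is
  `c₂ − ((r−1)/(2r)) c₁² = −κ₂`): twisting by a line bundle adds a central `t·1` to the curvature matrix and changes
  neither `ad X` (`adMatrix_add_smul_one` — "the scalar 2-form `Tr(Θ)` commutes with `α`") nor `X_tl`
  (`matrix_traceless_add_smul_one`, division-free `card_smul_sub_trace_smul_one_add_smul_one`) — "`κ(E) = κ(E ⊗ L)`";
  the dual connection `−Θᵀ` has `(−Xᵀ)_tl = −(X_tl)ᵀ` and the same `Tr(X_tl²)` (`matrix_traceless_neg_transpose`,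
  `trace_traceless_sq_neg_transpose` + division-free forms) — "`κ₂(F^*) = κ₂(F)`"; and **Lemma 2.4**
  "`c₂(End(F)) = −2rκ₂(F)`" is the trace identity **`Tr((ad X)²) = 2n·Tr(X_tl²)`** (`trace_adMatrix_sq_eq_traceless`
  over `ℂ`; division-free `card_mul_trace_adMatrix_sq`: `n·Tr((ad X)²) = 2·Tr((n·X − Tr X·1)²)` over any commutative
  ring), one `ring` step from §5's `trace_adMatrix_sq`; `trace_adMatrix_sq_add_smul_one` records that the `End` trace
  form is twist-invariant.

SCOPE (faithfulness). (i) Pointwise and infinitesimal only: "`G_M`-invariant" = "killed by `ad T`" for the given `T`;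
for the hyperkähler `𝔰𝔲(2)` take `T ∈ {I, J}` (`IsotropyAlgebraAction.lean`, `forall_unit_adAlt_twistorOp_eq_zero_iff`);
the statements hold for EVERY continuous `T`, which is more than the source needs. (ii) Nothing global: no bundle, no
connection, no Chern class or Chern–Weil theory — of Thm. 11.1 only the matrix-trace identities behind
`c₂(End B) = 2r·c₂(B) − (r−1)·c₁(B)²` are here (§5–§6); Thm. 11.1 as a statement about bundles, Thm. 11.2 (quadraticity
of `Spl(B)`) and Thm. 11.3 are NOT here; of Markman's Lemma 2.4 neither the (possibly twisted) sheaf, nor the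
reduction to the locally free case, nor `K`-theory or the splitting principle is formalised (§6 is its curvature-matrix
shadow only). (iii) The source's `B` is Hermitian holomorphic; the linear algebra needs no metric and no
complex structure on `E`, so none is assumed.

## References

* [Verbitsky1996Hyperholomorphic] M. Verbitsky, *Hyperholomorphic bundles over a hyperkähler manifold*, J. Alg. Geom. 5
  (1996) 633–669 = arXiv:alg-geom/9307008 (arXiv numbering), §11: Def. 11.1, Def. 11.2, Prop. 11.1 with proof (read on
  the arXiv v1 PDF, pp. 39–40).
* [Kobayashi1987] S. Kobayashi, *Differential Geometry of Complex Vector Bundles* (1987), I §1–§2 (curvature of `End(E)`,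
  projectively flat connections) — Verbitsky's "[Ko]".
* [Markman2020BBClass] E. Markman, J. Alg. Geom. 29 (2020) 199–245 = arXiv:1105.3223v4, §2 eq. (2.1) (p.5 L8–33),
  p.5 L34–42, Lemma 2.4 with proof (p.7 L19–27) — §6.
-/

noncomputable section

open Function Literature.LinearAlgebra.Alternating

namespace Literature.Geometry.Hyperkaehler

variable {E : Type*} [NormedAddCommGroup E] [NormedSpace ℝ E] {k : ℕ}

section NormedAlgebra

variable {A : Type*} [NormedRing A] [NormedAlgebra ℝ A]

/-! ### §1 `ad T` commutes with the commutator `[a, ·]` on the values -/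

/-- The inner derivation `x ↦ a x − x a` of the value algebra, applied after `Θ`, is the commutator covector
`[a, Θ] : v ↦ a Θ(v) − Θ(v) a`. [cite: Verbitsky1996Hyperholomorphic, Prop. 11.1 (proof: Θ₁(A) = Σ [A, Aᵢ] ωᵢ)] -/
theorem commutator_comp_apply (a : A) (Θ : E [⋀^Fin k]→L[ℝ] A) (v : Fin k → E) :
    (ContinuousLinearMap.mul ℝ A a - (ContinuousLinearMap.mul ℝ A).flip a).compContinuousAlternatingMap Θ v =
      a * Θ v - Θ v * a := by
  simp only [ContinuousLinearMap.compContinuousAlternatingMap_coe, comp_apply, FunLike.coe_sub,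
    Pi.sub_apply, ContinuousLinearMap.flip_apply, ContinuousLinearMap.mul_apply']

/-- **`ad T [a, Θ] = [a, ad T Θ]`**: Verbitsky's `ad T` acts on the form part only, so it commutes with the commutator
taken in the values ("Since `A` and `Θ₁` are `G_M`-invariant differential forms, the form `Θ₁(A) = Σᵢ [A, Aᵢ]ωᵢ` is
also `G_M`-invariant"). [cite: Verbitsky1996Hyperholomorphic, Prop. 11.1 (proof)] -/
theorem adAlt_commutator_comp (T : E →L[ℝ] E) (a : A) (Θ : E [⋀^Fin k]→L[ℝ] A) :
    adAlt T ((ContinuousLinearMap.mul ℝ A a - (ContinuousLinearMap.mul ℝ A).flip a).compContinuousAlternatingMap Θ) =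
      (ContinuousLinearMap.mul ℝ A a - (ContinuousLinearMap.mul ℝ A).flip a).compContinuousAlternatingMap (adAlt T Θ) :=
  (compContinuousAlternatingMap_adAlt _ T Θ).symm

/-! ### §2 Proposition 11.1, centre form: `End(B)` hyperholomorphic iff `ad T Θ` takes central values -/

/-- **Verbitsky's Prop. 11.1 at a point, centre form.** For a curvature value `Θ ∈ Alt^k(E; A)` and a derivation
`ad T`: the curvature `a ↦ [Θ, a]` of `End(B)` is killed by `ad T` (i.e. `ad T [a, Θ] = 0` for every `a`) iff every
value of `ad T Θ` commutes with all of `A` ("Therefore for any non-`G_M`-invariant `ωᵢ` the commutator `[A, Aᵢ] = 0`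
for any `A`"). [cite: Verbitsky1996Hyperholomorphic, Prop. 11.1] -/
theorem forall_adAlt_commutator_eq_zero_iff_forall_commute (T : E →L[ℝ] E) (Θ : E [⋀^Fin k]→L[ℝ] A) :
    (∀ a : A, adAlt T ((ContinuousLinearMap.mul ℝ A a -
        (ContinuousLinearMap.mul ℝ A).flip a).compContinuousAlternatingMap Θ) = 0) ↔
      ∀ (a : A) (v : Fin k → E), a * adAlt T Θ v = adAlt T Θ v * a := by
  constructor
  · intro h a v
    have h1 := congrArg (fun β : E [⋀^Fin k]→L[ℝ] A ↦ β v) (h a)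
    simp only [adAlt_commutator_comp, commutator_comp_apply, ContinuousAlternatingMap.coe_zero,
      Pi.zero_apply] at h1
    exact sub_eq_zero.mp h1
  · intro h a
    rw [adAlt_commutator_comp]
    ext v
    simp only [commutator_comp_apply, ContinuousAlternatingMap.coe_zero, Pi.zero_apply, h a v, sub_self]

/-- In a CENTRAL `𝕜`-algebra (`Algebra.IsCentral 𝕜 A`, e.g. `A = M_r(ℂ)` over `𝕜 = ℂ`) the central values of §2 are
scalars: if `ad T [a, Θ] = 0` for every `a`, then every value `(ad T Θ)(v)` is `f · Id` for a scalar `f`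
("Therefore `Aᵢ = f · Id` for such `i`, where `f` is a scalar function").
[cite: Verbitsky1996Hyperholomorphic, Prop. 11.1 (proof)] -/
theorem exists_eq_algebraMap_of_forall_adAlt_commutator_eq_zero (𝕜 : Type*) [Field 𝕜] [Algebra 𝕜 A]
    [Algebra.IsCentral 𝕜 A] (T : E →L[ℝ] E) (Θ : E [⋀^Fin k]→L[ℝ] A)
    (h : ∀ a : A, adAlt T ((ContinuousLinearMap.mul ℝ A a -
        (ContinuousLinearMap.mul ℝ A).flip a).compContinuousAlternatingMap Θ) = 0)
    (v : Fin k → E) : ∃ f : 𝕜, adAlt T Θ v = algebraMap 𝕜 A f := by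
  have hc : adAlt T Θ v ∈ Subalgebra.center 𝕜 A :=
    Subalgebra.mem_center_iff.mpr fun b ↦ (forall_adAlt_commutator_eq_zero_iff_forall_commute T Θ |>.mp h b v)
  exact (Algebra.IsCentral.mem_center_iff 𝕜).mp hc

/-! ### §3 Proposition 11.1 with the traceless curvature `Θ_tl = Θ − τ(Θ)` -/

/-- **Verbitsky's Prop. 11.1 at a point, traceless-curvature form.** Let `τ : A → A` be a continuous linear
"normalised trace" — its values are central and it fixes central elements (for `A = M_r(ℂ)`,
`τ(X) = (1/r) Tr(X) · Id`). Then `ad T [a, Θ] = 0` for every `a` (the curvature of `End(B)` is `ad T`-invariant) **iff**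
`ad T (Θ − τ ∘ Θ) = 0` (the traceless curvature `Θ_tl := Θ − (1/r) Tr(Θ)` of Def. 11.1 is `ad T`-invariant, Def. 11.2).
[cite: Verbitsky1996Hyperholomorphic, Prop. 11.1 / Def. 11.1 / Def. 11.2] -/
theorem forall_adAlt_commutator_eq_zero_iff_adAlt_sub_eq_zero (τ : A →L[ℝ] A)
    (hτc : ∀ (x a : A), a * τ x = τ x * a) (hτid : ∀ z : A, (∀ a : A, a * z = z * a) → τ z = z)
    (T : E →L[ℝ] E) (Θ : E [⋀^Fin k]→L[ℝ] A) :
    (∀ a : A, adAlt T ((ContinuousLinearMap.mul ℝ A a -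
        (ContinuousLinearMap.mul ℝ A).flip a).compContinuousAlternatingMap Θ) = 0) ↔
      adAlt T (Θ - τ.compContinuousAlternatingMap Θ) = 0 := by
  rw [forall_adAlt_commutator_eq_zero_iff_forall_commute, map_sub, ← compContinuousAlternatingMap_adAlt, sub_eq_zero]
  constructor
  · intro h
    ext v
    simp only [ContinuousLinearMap.compContinuousAlternatingMap_coe, comp_apply]
    exact (hτid _ fun a ↦ h a v).symm
  · intro h a v
    rw [h]
    simp only [ContinuousLinearMap.compContinuousAlternatingMap_coe, comp_apply]
    exact hτc _ a

/-- The easy direction of Prop. 11.1 separately, with no hypothesis on `τ` beyond central values: if the traceless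
part `Θ − τ ∘ Θ` is `ad T`-invariant then `End(B)` is `ad T`-invariant ("The last form is `G_M`-invariant if `B` is
projectively hyperholomorphic, and therefore `End(B)` is hyperholomorphic if `B` is projectively hyperholomorphic").
[cite: Verbitsky1996Hyperholomorphic, Prop. 11.1 (first half of the proof)] -/
theorem forall_adAlt_commutator_eq_zero_of_adAlt_sub_eq_zero (τ : A →L[ℝ] A)
    (hτc : ∀ (x a : A), a * τ x = τ x * a) (T : E →L[ℝ] E) (Θ : E [⋀^Fin k]→L[ℝ] A)
    (h : adAlt T (Θ - τ.compContinuousAlternatingMap Θ) = 0) (a : A) :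
    adAlt T ((ContinuousLinearMap.mul ℝ A a -
        (ContinuousLinearMap.mul ℝ A).flip a).compContinuousAlternatingMap Θ) = 0 := by
  rw [map_sub, ← compContinuousAlternatingMap_adAlt, sub_eq_zero] at h
  refine (forall_adAlt_commutator_eq_zero_iff_forall_commute T Θ).mpr (fun b v ↦ ?_) a
  rw [h]
  simp only [ContinuousLinearMap.compContinuousAlternatingMap_coe, comp_apply]
  exact hτc _ b

end NormedAlgebra

/-! ### §4 The matrix algebra `M_n(ℂ)`: `Θ_tl = Θ − (1/r) Tr(Θ) · Id` verbatim

Appended section (the "separate, appended section" announced in the module docstring). Mathlib deliberately gives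
`Matrix n n α` no global norm; the `ℓ∞`-operator norm family `Matrix.linftyOpNormedAddCommGroup / …NormedSpace /
…NormedRing / …NormedAlgebra` is switched on as LOCAL instances for this section only (any norm would do — the
statements are algebraic; consumers re-declare the same local instances). With `τ(X) = ((card n)⁻¹ · Tr X) · 1` the two
hypotheses of §3 are `matrix_normalisedTrace_central` / `matrix_normalisedTrace_of_central` (`Matrix.center_eq_range`:
a matrix commuting with every matrix is scalar), such a `τ` exists as a continuous `ℝ`-linear map
(`exists_matrix_normalisedTraceCLM`), and **`matrix_forall_adAlt_commutator_eq_zero_iff_adAlt_traceless_eq_zero`** is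
Prop. 11.1 at a point for `M_n(ℂ)`-valued curvature with Def. 11.1's traceless curvature written out. -/

section Matrix

variable {n : Type*} [Fintype n] [DecidableEq n]

attribute [local instance] Matrix.linftyOpNormedAddCommGroup Matrix.linftyOpNormedSpace
  Matrix.linftyOpNormedRing Matrix.linftyOpNormedAlgebra

/-- The normalised trace `X ↦ ((card n)⁻¹ · Tr X) · Id` takes central (scalar) values.
[cite: Verbitsky1996Hyperholomorphic, Def. 11.1 ("the scalar 2-form Tr(Θ) commutes with α")] -/
theorem matrix_normalisedTrace_central (X a : Matrix n n ℂ) :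
    a * ((((Fintype.card n : ℂ)⁻¹ * X.trace) • (1 : Matrix n n ℂ))) =
      (((Fintype.card n : ℂ)⁻¹ * X.trace) • (1 : Matrix n n ℂ)) * a := by
  rw [Matrix.mul_smul, Matrix.smul_mul, Matrix.mul_one, Matrix.one_mul]

/-- The normalised trace fixes central matrices: a matrix commuting with every matrix is `f · Id` with
`f = (1/r) Tr` of it (`n` non-empty). [cite: Verbitsky1996Hyperholomorphic, Prop. 11.1 (proof: "Aᵢ = f · Id")] -/
theorem matrix_normalisedTrace_of_central [Nonempty n] (z : Matrix n n ℂ) (hz : ∀ a : Matrix n n ℂ, a * z = z * a) :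
    ((Fintype.card n : ℂ)⁻¹ * z.trace) • (1 : Matrix n n ℂ) = z := by
  have hmem : z ∈ Set.center (Matrix n n ℂ) := Semigroup.mem_center_iff.mpr fun a ↦ hz a
  rw [Matrix.center_eq_range] at hmem
  obtain ⟨c, rfl⟩ := hmem
  have hn : (Fintype.card n : ℂ) ≠ 0 := Nat.cast_ne_zero.mpr Fintype.card_ne_zero
  have htr : (Matrix.scalar n c).trace = (Fintype.card n : ℂ) * c := by
    simp [Matrix.scalar_apply, Matrix.trace_diagonal, Finset.sum_const, Finset.card_univ]
  rw [htr, inv_mul_cancel_left₀ hn]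
  ext i j
  simp [Matrix.scalar_apply, Matrix.diagonal_apply, Matrix.one_apply]

/-- Non-vacuity of §4's `τ`: the normalised trace IS a continuous `ℝ`-linear map of `M_n(ℂ)`.
[cite: Verbitsky1996Hyperholomorphic, Def. 11.1] -/
theorem exists_matrix_normalisedTraceCLM :
    ∃ τ : Matrix n n ℂ →L[ℝ] Matrix n n ℂ,
      ∀ X, τ X = ((Fintype.card n : ℂ)⁻¹ * X.trace) • (1 : Matrix n n ℂ) := by
  let L : Matrix n n ℂ →ₗ[ℝ] Matrix n n ℂ :=
    { toFun := fun X ↦ ((Fintype.card n : ℂ)⁻¹ * X.trace) • (1 : Matrix n n ℂ)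
      map_add' := fun X Y ↦ by rw [Matrix.trace_add, mul_add, add_smul]
      map_smul' := fun c X ↦ by
        simp only [Matrix.trace_smul, RingHom.id_apply]
        rw [← smul_assoc, Complex.real_smul, Complex.real_smul]
        congr 1
        ring }
  exact ⟨LinearMap.toContinuousLinearMap L, fun X ↦ rfl⟩

/-- **Verbitsky's Prop. 11.1 at a point, for `M_n(ℂ)`-valued curvature, VERBATIM with Def. 11.1's
`Θ_tl = Θ − (1/r) Tr(Θ) · Id`.** For `Θ ∈ Alt^k_ℝ(E; M_n(ℂ))` (`n` non-empty), a derivation `ad T`, and the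
normalised trace `τ(X) = ((card n)⁻¹ Tr X) · Id` as a continuous linear map: the curvature `a ↦ [Θ, a]` of `End(B)`
is killed by `ad T` for every `a` **iff** `ad T (Θ − τ ∘ Θ) = 0`, i.e. iff the traceless curvature is `ad T`-invariant.
With `T ∈ {I, J}` of a hyperkähler structure this is "`End(B)` hyperholomorphic ⟺ `B` projectively
hyperholomorphic" at the point. [cite: Verbitsky1996Hyperholomorphic, Prop. 11.1 / Def. 11.1 / Def. 11.2] -/
theorem matrix_forall_adAlt_commutator_eq_zero_iff_adAlt_traceless_eq_zero [Nonempty n]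
    (τ : Matrix n n ℂ →L[ℝ] Matrix n n ℂ) (hτ : ∀ X, τ X = ((Fintype.card n : ℂ)⁻¹ * X.trace) • (1 : Matrix n n ℂ))
    (T : E →L[ℝ] E) (Θ : E [⋀^Fin k]→L[ℝ] Matrix n n ℂ) :
    (∀ a : Matrix n n ℂ, adAlt T ((ContinuousLinearMap.mul ℝ (Matrix n n ℂ) a -
        (ContinuousLinearMap.mul ℝ (Matrix n n ℂ)).flip a).compContinuousAlternatingMap Θ) = 0) ↔
      adAlt T (Θ - τ.compContinuousAlternatingMap Θ) = 0 :=
  forall_adAlt_commutator_eq_zero_iff_adAlt_sub_eq_zero τ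
    (fun X a ↦ ((congrArg (a * ·) (hτ X)).trans (matrix_normalisedTrace_central X a)).trans
      (congrArg (· * a) (hτ X)).symm)
    (fun z hz ↦ (hτ z).trans (matrix_normalisedTrace_of_central z hz)) T Θ

end Matrix

/-! ### §5 Theorem 11.1's class: the trace form of `ad` on `M_n(R)` (`c₂(End B) = 2r·c₂(B) − (r−1)·c₁(B)²`)

Appended with §4. Verbatim (p.40 L25–35): "Now, let `B` be Yang-Mills bundle over `M`. One can apply our version of
Bogomolov-Gieseker unequality ((5.1) and (5.1A)) to `End(B)` … **Theorem 11.1** The Yang-Mills bundle `B` of rank `r`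
over `(M, I)` is projectively hyperholomorphic if and only if the cohomology class `c₂(B) − ((r−1)/(2r)) c₁(B)²` is
`G_M`-invariant. This also follows from Theorem 2.5 applied to the bundle `End(B)` and Proposition 11.1." The step
"Theorem 2.5 applied to `End(B)`" needs the Chern classes of `End(B)` in terms of those of `B`:
`c₁(End B) = 0` and `c₂(End B) = 2r·c₂(B) − (r−1)·c₁(B)² = 2r·(c₂(B) − ((r−1)/(2r)) c₁(B)²)`. By Chern–Weil
(`c₁ ↔ Tr`, `2c₂ − c₁² ↔ −Tr(Θ²)` on even forms, which commute) both identities are the following two TRACE IDENTITIES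
for the operator `ad X : E ↦ XE − EX` on `M_n(R)` over any commutative ring `R` (the ring of even forms at a point):
`Tr(ad X) = 0` and `Tr((ad X)²) = 2n·Tr(X²) − 2·(Tr X)²` — so that `(Tr ad Θ)² − Tr((ad Θ)²) = 2·[(Tr Θ)² − n·Tr(Θ²)]
= 2n·[(Tr Θ)² − Tr(Θ²)] − 2(n−1)·(Tr Θ)²`, i.e. `2c₂(End) = 2n·2c₂(B) − 2(n−1)·c₁(B)²` in the normalisation
`2c₂ = (Tr Θ)² − Tr(Θ²)`, `c₁ = Tr Θ`. Only the matrix identities are formalised (the Chern–Weil dictionary is the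
tree's `Literature/Geometry/Kaehler/ChernWeilTransgression*.lean` business and is not touched here). -/

section TraceForm

variable {R : Type*} [CommRing R] {n : Type*} [Fintype n] [DecidableEq n]

omit [DecidableEq n] in
/-- Coordinates of a matrix in Mathlib's standard basis `Matrix.stdBasis` are its entries. [folklore] -/
private theorem matrix_stdBasis_repr_apply (M : Matrix n n R) (i j : n) :
    (Matrix.stdBasis R n n).repr M (i, j) = M i j := by
  classical
  simp [Matrix.stdBasis]

/-- The trace of an `R`-linear operator `f` on the matrix algebra `M_n(R)` is `∑ᵢⱼ f(E_{ij})_{ij}` (helper;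
trace computed in Mathlib's standard basis `Matrix.stdBasis`). [folklore] -/
private theorem trace_matrixOperator_eq_sum (f : Matrix n n R →ₗ[R] Matrix n n R) :
    LinearMap.trace R (Matrix n n R) f = ∑ i, ∑ j, f (Matrix.single i j 1) i j := by
  rw [LinearMap.trace_eq_matrix_trace R (Matrix.stdBasis R n n), Matrix.trace]
  simp only [Matrix.diag, LinearMap.toMatrix_apply, Matrix.stdBasis_eq_single, matrix_stdBasis_repr_apply,
    Fintype.sum_prod_type]

/-- **`Tr(ad X) = 0`** on `M_n(R)` (`ad X = L_X − R_X`): the first identity behind "Theorem 2.5 applied to the bundle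
`End(B)`" — `c₁(End B) = 0`. [cite: Verbitsky1996Hyperholomorphic, Thm 11.1 (the sentence "This also follows from Theorem 2.5 applied to the bundle End(B) and Proposition 11.1")] -/
theorem trace_adMatrix_eq_zero (X : Matrix n n R) :
    LinearMap.trace R (Matrix n n R) (LinearMap.mulLeft R X - LinearMap.mulRight R X) = 0 := by
  rw [trace_matrixOperator_eq_sum]
  simp only [LinearMap.sub_apply, LinearMap.mulLeft_apply, LinearMap.mulRight_apply, Matrix.sub_apply,
    Matrix.mul_apply, Matrix.single_apply, and_true, true_and, mul_ite, mul_one, mul_zero, ite_mul, one_mul,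
    zero_mul, Finset.sum_ite_eq, Finset.mem_univ, if_true, Finset.sum_sub_distrib]
  rw [Finset.sum_comm]
  exact sub_self _

/-- **`Tr((ad X)²) = 2n·Tr(X²) − 2·(Tr X)²`** on `M_n(R)`, `R` any commutative ring (the Killing-type trace form of
`𝔤𝔩_n`): the second identity behind "Theorem 2.5 applied to the bundle `End(B)`", i.e. (with `Tr(ad X) = 0`)
`c₂(End B) = 2r·c₂(B) − (r−1)·c₁(B)² = 2r·(c₂(B) − ((r−1)/(2r)) c₁(B)²)` — the class of Theorem 11.1.
[cite: Verbitsky1996Hyperholomorphic, Thm 11.1] -/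
theorem trace_adMatrix_sq (X : Matrix n n R) :
    LinearMap.trace R (Matrix n n R)
      ((LinearMap.mulLeft R X - LinearMap.mulRight R X) ∘ₗ (LinearMap.mulLeft R X - LinearMap.mulRight R X)) =
      2 * (Fintype.card n : R) * (X * X).trace - 2 * X.trace ^ 2 := by
  rw [trace_matrixOperator_eq_sum]
  have key : ∀ i j : n, ((LinearMap.mulLeft R X - LinearMap.mulRight R X) ∘ₗ
      (LinearMap.mulLeft R X - LinearMap.mulRight R X)) (Matrix.single i j 1) i j =
      (X * X) i i - 2 * (X i i * X j j) + (X * X) j j := by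
    intro i j
    have h1 : (X * (X * Matrix.single i j (1 : R))) i j = (X * X) i i := by
      rw [← Matrix.mul_assoc, Matrix.mul_single_apply_same, mul_one]
    have h2 : (X * (Matrix.single i j (1 : R) * X)) i j = X i i * X j j := by
      rw [Matrix.mul_apply, Finset.sum_eq_single i]
      · rw [Matrix.single_mul_apply_same, one_mul]
      · intro k _ hk; rw [Matrix.single_mul_apply_of_ne (1 : R) i j k j hk X, mul_zero]
      · intro h; exact absurd (Finset.mem_univ i) h
    have h3 : (X * Matrix.single i j (1 : R) * X) i j = X i i * X j j := by rw [Matrix.mul_assoc, h2]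
    have h4 : (Matrix.single i j (1 : R) * X * X) i j = (X * X) j j := by
      rw [Matrix.mul_assoc, Matrix.single_mul_apply_same, one_mul]
    simp only [LinearMap.coe_comp, Function.comp_apply, LinearMap.sub_apply, LinearMap.mulLeft_apply,
      LinearMap.mulRight_apply, Matrix.mul_sub, Matrix.sub_mul, Matrix.sub_apply, h1, h4,
      ← Matrix.mul_assoc X (Matrix.single i j 1) X, h3]
    ring
  have rowsum : ∀ i : n, ∑ j, ((LinearMap.mulLeft R X - LinearMap.mulRight R X) ∘ₗ
      (LinearMap.mulLeft R X - LinearMap.mulRight R X)) (Matrix.single i j 1) i j =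
      (Fintype.card n : R) * (X * X) i i - 2 * X i i * X.trace + (X * X).trace := by
    intro i
    simp only [key, Finset.sum_add_distrib, Finset.sum_sub_distrib, Finset.sum_const, Finset.card_univ,
      nsmul_eq_mul, ← Finset.mul_sum, Matrix.trace, Matrix.diag]
    ring
  simp only [rowsum, Finset.sum_add_distrib, Finset.sum_sub_distrib, Finset.sum_const, Finset.card_univ,
    nsmul_eq_mul, ← Finset.mul_sum, ← Finset.sum_mul]
  simp only [Matrix.trace, Matrix.diag, sq]
  ring

/-- The two identities combined in the shape Chern–Weil uses (`2c₂ = (Tr Θ)² − Tr Θ²`, `c₁ = Tr Θ`):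
`(Tr ad X)² − Tr((ad X)²) = 2n·((Tr X)² − Tr(X²)) − 2(n − 1)·(Tr X)²`, i.e. `c₂(End B) = 2r c₂(B) − (r−1) c₁(B)²`.
[cite: Verbitsky1996Hyperholomorphic, Thm 11.1] -/
theorem trace_adMatrix_chernTwo (X : Matrix n n R) :
    LinearMap.trace R (Matrix n n R) (LinearMap.mulLeft R X - LinearMap.mulRight R X) ^ 2 -
      LinearMap.trace R (Matrix n n R) ((LinearMap.mulLeft R X - LinearMap.mulRight R X) ∘ₗ
        (LinearMap.mulLeft R X - LinearMap.mulRight R X)) =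
      2 * (Fintype.card n : R) * (X.trace ^ 2 - (X * X).trace) - 2 * ((Fintype.card n : R) - 1) * X.trace ^ 2 := by
  rw [trace_adMatrix_eq_zero, trace_adMatrix_sq]
  ring

end TraceForm

/-! ### §6 Markman's `κ`-class dictionary: `κ(E ⊗ L) = κ(E)`, `κ₂(F^*) = κ₂(F)`, and Lemma 2.4 `c₂(End F) = −2r·κ₂(F)`

Appended after §5 landed. With `X ∈ M_n(R)` the curvature matrix over the commutative ring `R` of even forms (Chern–Weil:
identities of `GL_n`-invariant polynomials on `𝔤𝔩_n` are identities of characteristic forms): `c₁ ↔ Tr X`,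
`ch₂ ↔ ½Tr(X²)`, `2c₂ ↔ (Tr X)² − Tr(X²)`; the Chern roots of `End F` are the `y_i − y_j` (curvature `ad X = L_X − R_X`);
Markman's `κ = ch·exp(−c₁/r)` is `ch` of the normalised roots `y_j − ȳ`, i.e. of the TRACELESS PART
`X_tl = X − ((1/n) Tr X)·1` of Def. 11.1: `κ₁ ↔ Tr X_tl = 0`, `κ₂ ↔ ½Tr(X_tl²)`, and Thm. 11.1's class is `−κ₂`. The
division-free forms use `n·X_tl = n·X − Tr(X)·1` and hold over any commutative ring; the verbatim forms are over `ℂ` with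
`n` non-empty (as in §4). -/

section Kappa

variable {R : Type*} [CommRing R] {n : Type*} [Fintype n] [DecidableEq n]

/-! #### §6.1 Twisting by a line bundle: `ad X` and the traceless part do not see a central `t·1` — `κ(E ⊗ L) = κ(E)` -/

/-- **`ad(X + t·1) = ad X`** on `M_n(R)`: adding a central term to the curvature matrix (twisting by a line bundle,
`Θ_{E⊗L} = Θ_E + Θ_L·1`) does not change the curvature `ad Θ = L_Θ − R_Θ` of the endomorphism bundle.
[cite: Verbitsky1996Hyperholomorphic, Prop. 11.1 (proof: "because the scalar 2-form Tr(Θ) commutes with α")] -/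
theorem adMatrix_add_smul_one (X : Matrix n n R) (t : R) :
    LinearMap.mulLeft R (X + t • (1 : Matrix n n R)) - LinearMap.mulRight R (X + t • (1 : Matrix n n R)) =
      LinearMap.mulLeft R X - LinearMap.mulRight R X := by
  refine LinearMap.ext fun Y ↦ ?_
  simp only [LinearMap.sub_apply, LinearMap.mulLeft_apply, LinearMap.mulRight_apply, Matrix.add_mul,
    Matrix.mul_add, Matrix.smul_mul, Matrix.mul_smul, Matrix.one_mul, Matrix.mul_one]
  abel

/-- **`κ(E ⊗ L) = κ(E)`, division-free matrix form**: the scaled traceless part `n·X − Tr(X)·1` (`= n·X_tl`) is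
unchanged under `X ↦ X + t·1`. [cite: Markman2020BBClass, §2 p.5 L34–36 ("the equality κ(E) = κ(E ⊗ L) thus holds, for any line bundle L")] -/
theorem card_smul_sub_trace_smul_one_add_smul_one (X : Matrix n n R) (t : R) :
    (Fintype.card n : R) • (X + t • (1 : Matrix n n R)) - (X + t • (1 : Matrix n n R)).trace • (1 : Matrix n n R) =
      (Fintype.card n : R) • X - X.trace • (1 : Matrix n n R) := by
  rw [smul_add, smul_smul, Matrix.trace_add, Matrix.trace_smul, Matrix.trace_one, smul_eq_mul, add_smul,
    mul_comm t]
  abel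

/-- **`κ(E ⊗ L) = κ(E)`, verbatim normalisation over `ℂ`**: Verbitsky's traceless part `X_tl = X − ((1/n) Tr X)·1`
(Def. 11.1; its Chern roots are Markman's `y_j − (Σ_k y_k)/r`) is unchanged under `X ↦ X + t·1`.
[cite: Markman2020BBClass, §2 eq. (2.1) and p.5 L34–36] [cite: Verbitsky1996Hyperholomorphic, Def. 11.1] -/
theorem matrix_traceless_add_smul_one [Nonempty n] (X : Matrix n n ℂ) (t : ℂ) :
    (X + t • (1 : Matrix n n ℂ)) - ((Fintype.card n : ℂ)⁻¹ * (X + t • (1 : Matrix n n ℂ)).trace) • (1 : Matrix n n ℂ) =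
      X - ((Fintype.card n : ℂ)⁻¹ * X.trace) • (1 : Matrix n n ℂ) := by
  have hn : (Fintype.card n : ℂ) ≠ 0 := Nat.cast_ne_zero.mpr Fintype.card_ne_zero
  have h : (Fintype.card n : ℂ)⁻¹ * (X + t • (1 : Matrix n n ℂ)).trace = (Fintype.card n : ℂ)⁻¹ * X.trace + t := by
    rw [Matrix.trace_add, Matrix.trace_smul, Matrix.trace_one, smul_eq_mul, mul_add, mul_comm t, ← mul_assoc,
      inv_mul_cancel₀ hn, one_mul]
  rw [h, add_smul]
  abel

/-! #### §6.2 Duality: the dual connection's curvature `−Θᵀ` — `κ₂(F^*) = κ₂(F)` -/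

/-- **`κᵢ(F^*) = (−1)ⁱκᵢ(F)`, degree 1, division-free matrix form**: `n·(−Xᵀ) − Tr(−Xᵀ)·1 = −(n·X − Tr(X)·1)ᵀ`.
[cite: Markman2020BBClass, §2 p.5 L36–42 ("κᵢ(y^∨) = (−1)ⁱκᵢ(y)") and Lemma 2.4 (proof: "κ₂(F^*) = κ₂(F)")] -/
theorem card_smul_sub_trace_smul_one_neg_transpose (X : Matrix n n R) :
    (Fintype.card n : R) • (-X.transpose) - (-X.transpose).trace • (1 : Matrix n n R) =
      -((Fintype.card n : R) • X - X.trace • (1 : Matrix n n R)).transpose := by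
  rw [Matrix.trace_neg, Matrix.trace_transpose, Matrix.transpose_sub, Matrix.transpose_smul, Matrix.transpose_smul,
    Matrix.transpose_one, smul_neg, neg_smul]
  abel

/-- **`κ₂(F^*) = κ₂(F)`, division-free matrix form**: `Tr((n·(−Xᵀ) − Tr(−Xᵀ)·1)²) = Tr((n·X − Tr(X)·1)²)` — the
step "Note that `κ₂(F^*) = κ₂(F)`" of the proof of Lemma 2.4. [cite: Markman2020BBClass, Lemma 2.4 (proof, p.7 L24)] -/
theorem trace_sq_card_smul_sub_trace_smul_one_neg_transpose (X : Matrix n n R) :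
    (((Fintype.card n : R) • (-X.transpose) - (-X.transpose).trace • (1 : Matrix n n R)) *
        ((Fintype.card n : R) • (-X.transpose) - (-X.transpose).trace • (1 : Matrix n n R))).trace =
      (((Fintype.card n : R) • X - X.trace • (1 : Matrix n n R)) *
        ((Fintype.card n : R) • X - X.trace • (1 : Matrix n n R))).trace := by
  rw [card_smul_sub_trace_smul_one_neg_transpose, neg_mul_neg, ← Matrix.transpose_mul, Matrix.trace_transpose]

/-- **`(−Xᵀ)_tl = −(X_tl)ᵀ`** over `ℂ` (verbatim normalisation `X_tl = X − ((1/n) Tr X)·1`).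
[cite: Markman2020BBClass, §2 p.5 L36–42] [cite: Verbitsky1996Hyperholomorphic, Def. 11.1] -/
theorem matrix_traceless_neg_transpose [Nonempty n] (X : Matrix n n ℂ) :
    (-X.transpose) - ((Fintype.card n : ℂ)⁻¹ * (-X.transpose).trace) • (1 : Matrix n n ℂ) =
      -(X - ((Fintype.card n : ℂ)⁻¹ * X.trace) • (1 : Matrix n n ℂ)).transpose := by
  rw [Matrix.trace_neg, Matrix.trace_transpose, Matrix.transpose_sub, Matrix.transpose_smul, Matrix.transpose_one,
    mul_neg, neg_smul]
  abel

/-- **`κ₂(F^*) = κ₂(F)`** over `ℂ`: `Tr(((−Xᵀ)_tl)²) = Tr(X_tl²)`. [cite: Markman2020BBClass, Lemma 2.4 (proof, p.7 L24)] -/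
theorem trace_traceless_sq_neg_transpose [Nonempty n] (X : Matrix n n ℂ) :
    (((-X.transpose) - ((Fintype.card n : ℂ)⁻¹ * (-X.transpose).trace) • (1 : Matrix n n ℂ)) *
        ((-X.transpose) - ((Fintype.card n : ℂ)⁻¹ * (-X.transpose).trace) • (1 : Matrix n n ℂ))).trace =
      ((X - ((Fintype.card n : ℂ)⁻¹ * X.trace) • (1 : Matrix n n ℂ)) *
        (X - ((Fintype.card n : ℂ)⁻¹ * X.trace) • (1 : Matrix n n ℂ))).trace := by
  rw [matrix_traceless_neg_transpose, neg_mul_neg, ← Matrix.transpose_mul, Matrix.trace_transpose]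

/-! #### §6.3 Lemma 2.4: `c₂(End F) = −2r·κ₂(F)`, i.e. `Tr((ad X)²) = 2n·Tr(X_tl²)` -/

/-- **Markman's Lemma 2.4, division-free matrix form**: `n · Tr((ad X)²) = 2 · Tr((n·X − Tr(X)·1)²)` on `M_n(R)`,
`R` any commutative ring — with `n·X − Tr(X)·1 = n·X_tl` this is `Tr((ad X)²) = 2n·Tr(X_tl²)`, the curvature-matrix
form of `ch₂(End F) = 2r·κ₂(F)`, i.e. (as `c₁(End F) = 0`, §5's `trace_adMatrix_eq_zero`)
of `c₂(End(F)) = −2rκ₂(F)`. [cite: Markman2020BBClass, Lemma 2.4] -/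
theorem card_mul_trace_adMatrix_sq (X : Matrix n n R) :
    (Fintype.card n : R) * LinearMap.trace R (Matrix n n R)
        ((LinearMap.mulLeft R X - LinearMap.mulRight R X) ∘ₗ (LinearMap.mulLeft R X - LinearMap.mulRight R X)) =
      2 * (((Fintype.card n : R) • X - X.trace • (1 : Matrix n n R)) *
        ((Fintype.card n : R) • X - X.trace • (1 : Matrix n n R))).trace := by
  rw [trace_adMatrix_sq]
  simp only [Matrix.sub_mul, Matrix.mul_sub, Matrix.smul_mul, Matrix.mul_smul, Matrix.one_mul, Matrix.mul_one,
    Matrix.trace_sub, Matrix.trace_smul, Matrix.trace_one, smul_eq_mul]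
  ring

/-- **Markman's Lemma 2.4 at the curvature-matrix level, verbatim normalisation** (over `ℂ`, `n` non-empty):
`Tr((ad X)²) = 2n · Tr(X_tl²)` with `X_tl = X − ((1/n) Tr X)·1` — `ch₂(End F) = 2r·κ₂(F)`, equivalently
`c₂(End(F)) = −2rκ₂(F)` ("`κ₂(End(F)) = ch₂(End(F)) = −c₂(End(F))`"); with `κ₂ = −(c₂ − ((r−1)/(2r)) c₁²)` this is
Verbitsky's "Theorem 2.5 applied to the bundle `End(B)`" form of Theorem 11.1's class.
[cite: Markman2020BBClass, Lemma 2.4] [cite: Verbitsky1996Hyperholomorphic, Thm. 11.1] -/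
theorem trace_adMatrix_sq_eq_traceless [Nonempty n] (X : Matrix n n ℂ) :
    LinearMap.trace ℂ (Matrix n n ℂ)
        ((LinearMap.mulLeft ℂ X - LinearMap.mulRight ℂ X) ∘ₗ (LinearMap.mulLeft ℂ X - LinearMap.mulRight ℂ X)) =
      2 * (Fintype.card n : ℂ) * ((X - ((Fintype.card n : ℂ)⁻¹ * X.trace) • (1 : Matrix n n ℂ)) *
        (X - ((Fintype.card n : ℂ)⁻¹ * X.trace) • (1 : Matrix n n ℂ))).trace := by
  have hn : (Fintype.card n : ℂ) ≠ 0 := Nat.cast_ne_zero.mpr Fintype.card_ne_zero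
  rw [trace_adMatrix_sq]
  simp only [Matrix.sub_mul, Matrix.mul_sub, Matrix.smul_mul, Matrix.mul_smul, Matrix.one_mul, Matrix.mul_one,
    Matrix.trace_sub, Matrix.trace_smul, Matrix.trace_one, smul_eq_mul]
  field_simp
  ring

/-- The two halves together: the `End`-curvature trace form is twist-invariant,
`Tr((ad (X + t·1))²) = Tr((ad X)²)` — "`c₂(End(F))` is a scalar multiple of `κ₂(F)`" and `κ(F ⊗ L) = κ(F)`.
[cite: Markman2020BBClass, Lemma 2.4 and §2 p.5 L34–36] -/
theorem trace_adMatrix_sq_add_smul_one (X : Matrix n n R) (t : R) :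
    LinearMap.trace R (Matrix n n R)
        ((LinearMap.mulLeft R (X + t • (1 : Matrix n n R)) - LinearMap.mulRight R (X + t • (1 : Matrix n n R))) ∘ₗ
          (LinearMap.mulLeft R (X + t • (1 : Matrix n n R)) - LinearMap.mulRight R (X + t • (1 : Matrix n n R)))) =
      LinearMap.trace R (Matrix n n R)
        ((LinearMap.mulLeft R X - LinearMap.mulRight R X) ∘ₗ (LinearMap.mulLeft R X - LinearMap.mulRight R X)) := by
  rw [adMatrix_add_smul_one]

end Kappa

end Literature.Geometry.Hyperkaehler

end
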